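import Literature.AlgebraicGeometry.Frobenioids.Prop53Sub
import HarnessLib

/-!
# Frobenioids I, Corollary 5.4 — sub-DAG row C54/L04 `Cor54Sub.RealSpanCompat`, PROVED

Proof-only companion to `Prop53Sub.lean` (abc-iut cell, layer L1; SUBDAG-FrdI-Prop53-Cor54.md row C54/L04;
seat abc-iut-w5-d097 under L1-lead R94 (1); statements by abc-iut-w5-d137, p414830).

S. Mochizuki, *The geometry of Frobenioids I*, Kyushu J. Math. **62** (2008), Prop. 5.3 p. 103 l. 13–16
(`ℝ · Φ^birat ⊆ (Φ^rlf)^gp` := "the `ℝ`-vector subspace of `(Φ^rlf)^gp(A_D)` generated by `Φ^birat(A_D)`") and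
Cor. 5.4 p. 104 l. 21 [cite: MochizukiFrdI2008, Cor. 5.4 p.104].  Row C54/L04: granted C54/L03
(`BiratCompat`: `Ψ^Φ` carries `Φ₁^birat(X)` onto `Φ₂^birat(Ψ^Base X)`), ANY isomorphism
`Φ₁^rlf ⥲ Φ₂^rlf` over `Ψ^Base` that lies over `Ψ^Φ` along `Φ_i → Φ_i^rlf` carries THE span `ℝ · Φ₁^birat(X)`
onto `ℝ · Φ₂^birat(Ψ^Base X)`.
The one non-formal input is abc-iut-L1-d2's `IsPerfFactorial.Rlf.map_realSMul` (RealificationDataCanonical /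
RlfHomEquivariant): EVERY monoid homomorphism `M^rlf → N^rlf` of realifications is `ℝ`-linear on
groupifications — so no linearity hypothesis on the realified isomorphism is needed.

* `map_rlfIso_rsmul` — `((Ψ^Φ)^rlf_X)^gp` (spelled `MonGp.map (Erlf.iso X)` on `(Φ_i(−)^rlf)^gp`) is `ℝ`-linear
  (`map_realSMul`);
* `map_rlfIso_toRlfGp` — it lies over `(Ψ^Φ)^gp` along `ι_i : Φ_i^gp → (Φ_i^rlf)^gp` (from the hypothesis on `Φ_i`);
* `realSpanCompat_holds` — **`Cor54Sub.RealSpanCompat F₁ hΦ₁ F₂ hΦ₂ Ψ^Base E Erlf` for all `E`, `Erlf`**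
  (generator chase on `realSpanGen = {r • ι(c)}`).

No new definition of the paper's notions, no `Prop` hypothesis beyond the row's own; nothing here bears on
[IUTchIII]; typed ≠ proved for the other rows.
-/

noncomputable section

namespace Literature.AlgebraicGeometry.Frobenioids

open CategoryTheory Opposite Literature.AnabelianGeometry.EtaleTheta

universe w v v' u u' v₁ v₁' u₁ u₁' v₂ v₂' u₂ u₂'

namespace FrdI.Cor54Sub

variable {D₁ : Type u₁'} [Category.{v₁'} D₁] {Φ₁ : D₁ᵒᵖ ⥤ CommMonCat.{w}}
  {C₁ : Type u₁} [Category.{v₁} C₁] (F₁ : C₁ ⥤ ElemFrobenioid Φ₁) (hΦ₁ : PreFrobenioid.IsPerfFactorialOn Φ₁)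
  {D₂ : Type u₂'} [Category.{v₂'} D₂] {Φ₂ : D₂ᵒᵖ ⥤ CommMonCat.{w}}
  {C₂ : Type u₂} [Category.{v₂} C₂] (F₂ : C₂ ⥤ ElemFrobenioid Φ₂) (hΦ₂ : PreFrobenioid.IsPerfFactorialOn Φ₂)
  {ΨBase : D₁ ⥤ D₂}
  (E : PreFrobenioidData.DivisorMonoidIsoOverBase
    (PreFrobenioidData.ofFunctor Φ₁ F₁) (PreFrobenioidData.ofFunctor Φ₂ F₂) ΨBase)
  (Erlf : PreFrobenioidData.DivisorMonoidIsoOverBase (rlfData F₁ hΦ₁) (rlfData F₂ hΦ₂) ΨBase)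

/-- **`((Ψ^Φ)^rlf_X)^gp` is `ℝ`-linear** — for free, by abc-iut-L1-d2's automatic `ℝ`-linearity of homomorphisms
of realifications (`IsPerfFactorial.Rlf.map_realSMul`); THE `ℝ`-action of the canonical realification data is
`realSMul` (`canonical_rsmul`). [cite: MochizukiFrdI2008, Def. 2.4 (i) p.48] -/
theorem map_rlfIso_rsmul (X : D₁) (r : ℝ)
    (ξ : Algebra.GrothendieckGroup (PreFrobenioid.IsPerfFactorialOn.op hΦ₁ (op X)).Rlf) :
    MonGp.map (M := (PreFrobenioid.IsPerfFactorialOn.op hΦ₁ (op X)).Rlf)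
          (N := (PreFrobenioid.IsPerfFactorialOn.op hΦ₂ (op (ΨBase.obj X))).Rlf) (Erlf.iso X).toMonoidHom
        ((RealificationData.canonical Φ₁ (PreFrobenioid.IsPerfFactorialOn.op hΦ₁)).rsmul X r ξ) =
      (RealificationData.canonical Φ₂ (PreFrobenioid.IsPerfFactorialOn.op hΦ₂)).rsmul (ΨBase.obj X) r
        ((MonGp.map (M := (PreFrobenioid.IsPerfFactorialOn.op hΦ₁ (op X)).Rlf)
          (N := (PreFrobenioid.IsPerfFactorialOn.op hΦ₂ (op (ΨBase.obj X))).Rlf) (Erlf.iso X).toMonoidHom) ξ) := by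
  rw [RealificationData.canonical_rsmul, RealificationData.canonical_rsmul]
  exact IsPerfFactorial.Rlf.map_realSMul _ _ (Erlf.iso X).toMonoidHom r ξ

/-- **`((Ψ^Φ)^rlf)^gp` lies over `(Ψ^Φ)^gp` along `ι_i : Φ_i^gp → (Φ_i^rlf)^gp`**, granted that `(Ψ^Φ)^rlf` lies
over `Ψ^Φ` along `Φ_i → Φ_i^rlf` (the row's hypothesis; checked on the generators `[a]`).
[cite: MochizukiFrdI2008, Cor. 5.4 p.104] -/
theorem map_rlfIso_toRlfGp
    (hover : ∀ (X : D₁) (x : Φ₁.obj (op X)),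
      Erlf.iso X (((toRlfNatTrans Φ₁ (PreFrobenioid.IsPerfFactorialOn.op hΦ₁)).app (op X)).hom x) =
        ((toRlfNatTrans Φ₂ (PreFrobenioid.IsPerfFactorialOn.op hΦ₂)).app (op (ΨBase.obj X))).hom (E.iso X x))
    (X : D₁) (c : Algebra.GrothendieckGroup (Φ₁.obj (op X))) :
    MonGp.map (M := (PreFrobenioid.IsPerfFactorialOn.op hΦ₁ (op X)).Rlf)
          (N := (PreFrobenioid.IsPerfFactorialOn.op hΦ₂ (op (ΨBase.obj X))).Rlf) (Erlf.iso X).toMonoidHom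
        ((RealificationData.canonical Φ₁ (PreFrobenioid.IsPerfFactorialOn.op hΦ₁)).toRlfGp X c) =
      (RealificationData.canonical Φ₂ (PreFrobenioid.IsPerfFactorialOn.op hΦ₂)).toRlfGp (ΨBase.obj X)
        ((MonGp.map (M := Φ₁.obj (op X)) (N := Φ₂.obj (op (ΨBase.obj X)))
          (E.iso X).toMonoidHom) c) := by
  have key : ((MonGp.map (M := (PreFrobenioid.IsPerfFactorialOn.op hΦ₁ (op X)).Rlf)
          (N := (PreFrobenioid.IsPerfFactorialOn.op hΦ₂ (op (ΨBase.obj X))).Rlf) (Erlf.iso X).toMonoidHom)).comp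
        ((RealificationData.canonical Φ₁ (PreFrobenioid.IsPerfFactorialOn.op hΦ₁)).toRlfGp X) =
      ((RealificationData.canonical Φ₂ (PreFrobenioid.IsPerfFactorialOn.op hΦ₂)).toRlfGp (ΨBase.obj X)).comp
        ((MonGp.map (M := Φ₁.obj (op X)) (N := Φ₂.obj (op (ΨBase.obj X)))
          (E.iso X).toMonoidHom)) := by
    refine MonGp.hom_ext fun a => ?_
    -- the two sides on a generator `[a]`, `a ∈ Φ₁(X)`
    have hL : (((MonGp.map (M := (PreFrobenioid.IsPerfFactorialOn.op hΦ₁ (op X)).Rlf)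
          (N := (PreFrobenioid.IsPerfFactorialOn.op hΦ₂ (op (ΨBase.obj X))).Rlf) (Erlf.iso X).toMonoidHom)).comp
          ((RealificationData.canonical Φ₁ (PreFrobenioid.IsPerfFactorialOn.op hΦ₁)).toRlfGp X))
          (Algebra.GrothendieckGroup.of a) =
        Algebra.GrothendieckGroup.of (Erlf.iso X
          (((RealificationData.canonical Φ₁ (PreFrobenioid.IsPerfFactorialOn.op hΦ₁)).toRlf.app (op X)).hom a)) := by
      change (MonGp.map (M := (PreFrobenioid.IsPerfFactorialOn.op hΦ₁ (op X)).Rlf)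
          (N := (PreFrobenioid.IsPerfFactorialOn.op hΦ₂ (op (ΨBase.obj X))).Rlf) (Erlf.iso X).toMonoidHom)
          (MonGp.map ((RealificationData.canonical Φ₁ (PreFrobenioid.IsPerfFactorialOn.op hΦ₁)).toRlf.app
            (op X)).hom (Algebra.GrothendieckGroup.of a)) = _
      rw [MonGp.map_of]
      exact MonGp.map_of _ _
    have hR : (((RealificationData.canonical Φ₂ (PreFrobenioid.IsPerfFactorialOn.op hΦ₂)).toRlfGp
          (ΨBase.obj X)).comp ((MonGp.map (M := Φ₁.obj (op X)) (N := Φ₂.obj (op (ΨBase.obj X)))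
          (E.iso X).toMonoidHom))) (Algebra.GrothendieckGroup.of a) =
        Algebra.GrothendieckGroup.of
          (((RealificationData.canonical Φ₂ (PreFrobenioid.IsPerfFactorialOn.op hΦ₂)).toRlf.app
            (op (ΨBase.obj X))).hom (E.iso X a)) := by
      change MonGp.map ((RealificationData.canonical Φ₂ (PreFrobenioid.IsPerfFactorialOn.op hΦ₂)).toRlf.app
          (op (ΨBase.obj X))).hom ((MonGp.map (M := Φ₁.obj (op X)) (N := Φ₂.obj (op (ΨBase.obj X)))
          (E.iso X).toMonoidHom) (Algebra.GrothendieckGroup.of a)) = _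
      rw [MonGp.map_of]
      exact MonGp.map_of _ _
    -- the row's hypothesis, read for THE realification data (`canonical_toRlf`: its `Φ → Φ^rlf` IS `toRlfNatTrans`)
    have hover' : Erlf.iso X
          (((RealificationData.canonical Φ₁ (PreFrobenioid.IsPerfFactorialOn.op hΦ₁)).toRlf.app (op X)).hom a) =
        ((RealificationData.canonical Φ₂ (PreFrobenioid.IsPerfFactorialOn.op hΦ₂)).toRlf.app
          (op (ΨBase.obj X))).hom (E.iso X a) :=
      hover X a
    exact hL.trans ((congrArg Algebra.GrothendieckGroup.of hover').trans hR.symm)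
  exact DFunLike.congr_fun key c

/-- **C54/L04, PROVED** ([FrdI] Cor. 5.4 with Prop. 5.3's `ℝ · Φ^birat`): granted `BiratCompat` (row C54/L03),
ANY realified `Ψ^Φ` lying over `Ψ^Φ` along `Φ_i → Φ_i^rlf` carries THE span `ℝ · Φ₁^birat(X)` onto
`ℝ · Φ₂^birat(Ψ^Base X)`: the generators `r • ι₁(c)`, `c ∈ Φ₁^birat(X)`, go to `r • ι₂(Ψ^Φ c)`
(`map_rlfIso_rsmul`, `map_rlfIso_toRlfGp`) with `Ψ^Φ c ∈ Φ₂^birat(Ψ^Base X)`, and conversely every generator of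
the target span is of that form since `Ψ^Φ` maps `Φ₁^birat(X)` ONTO `Φ₂^birat(Ψ^Base X)`.
[cite: MochizukiFrdI2008, Cor. 5.4 p.104] -/
theorem realSpanCompat_holds : RealSpanCompat F₁ hΦ₁ F₂ hΦ₂ ΨBase E Erlf := by
  intro hBC hover X
  have hBCX : Subgroup.map ((MonGp.map (M := Φ₁.obj (op X)) (N := Φ₂.obj (op (ΨBase.obj X)))
          (E.iso X).toMonoidHom)) ((PreFrobenioid.biratSubfunctor F₁).carrier X) =
      (PreFrobenioid.biratSubfunctor F₂).carrier (ΨBase.obj X) := hBC X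
  change Subgroup.map ((MonGp.map (M := (PreFrobenioid.IsPerfFactorialOn.op hΦ₁ (op X)).Rlf)
          (N := (PreFrobenioid.IsPerfFactorialOn.op hΦ₂ (op (ΨBase.obj X))).Rlf) (Erlf.iso X).toMonoidHom))
      (((RealificationData.canonical Φ₁ (PreFrobenioid.IsPerfFactorialOn.op hΦ₁)).realSpan
        (PreFrobenioid.biratSubfunctor F₁)).carrier X) =
    ((RealificationData.canonical Φ₂ (PreFrobenioid.IsPerfFactorialOn.op hΦ₂)).realSpan
        (PreFrobenioid.biratSubfunctor F₂)).carrier (ΨBase.obj X)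
  -- the image of a generator `r • ι₁(c)` is the generator `r • ι₂(Ψ^Φ c)`
  have himg : ∀ (r : ℝ) (c : Algebra.GrothendieckGroup (Φ₁.obj (op X))),
      (MonGp.map (M := (PreFrobenioid.IsPerfFactorialOn.op hΦ₁ (op X)).Rlf)
          (N := (PreFrobenioid.IsPerfFactorialOn.op hΦ₂ (op (ΨBase.obj X))).Rlf) (Erlf.iso X).toMonoidHom)
          ((RealificationData.canonical Φ₁ (PreFrobenioid.IsPerfFactorialOn.op hΦ₁)).rsmul X r
            ((RealificationData.canonical Φ₁ (PreFrobenioid.IsPerfFactorialOn.op hΦ₁)).toRlfGp X c)) =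
        (RealificationData.canonical Φ₂ (PreFrobenioid.IsPerfFactorialOn.op hΦ₂)).rsmul (ΨBase.obj X) r
          ((RealificationData.canonical Φ₂ (PreFrobenioid.IsPerfFactorialOn.op hΦ₂)).toRlfGp (ΨBase.obj X)
            ((MonGp.map (M := Φ₁.obj (op X)) (N := Φ₂.obj (op (ΨBase.obj X)))
          (E.iso X).toMonoidHom) c)) := fun r c => by
    rw [map_rlfIso_rsmul, map_rlfIso_toRlfGp F₁ hΦ₁ F₂ hΦ₂ E Erlf hover]
  apply le_antisymm
  · -- "⊆"
    refine Subgroup.map_le_iff_le_comap.mpr ((Subgroup.closure_le _).mpr ?_)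
    rintro _ ⟨r, c, hc, rfl⟩
    refine Subgroup.mem_comap.mpr ((congrArg (· ∈ _) (himg r c)).mpr ?_)
    refine Subgroup.subset_closure ⟨r, (MonGp.map (M := Φ₁.obj (op X)) (N := Φ₂.obj (op (ΨBase.obj X)))
          (E.iso X).toMonoidHom) c, ?_, rfl⟩
    rw [← hBCX]
    exact Subgroup.mem_map_of_mem _ hc
  · -- "⊇": every generator `r • ι₂(c')`, `c' ∈ Φ₂^birat(Ψ^Base X) = Ψ^Φ(Φ₁^birat(X))`, is an image
    refine (Subgroup.closure_le _).mpr ?_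
    rintro _ ⟨r, c', hc', rfl⟩
    rw [← hBCX] at hc'
    obtain ⟨c, hc, rfl⟩ := hc'
    exact ⟨_, Subgroup.subset_closure ⟨r, c, hc, rfl⟩, himg r c⟩

end FrdI.Cor54Sub

end Literature.AlgebraicGeometry.Frobenioids

end
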